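import Summits.BirchSwinnertonDyer.BirchSwinnertonDyer.Theorems.SignedLowerHalvesKobayashiMainConjectureSmallImageTeichOrbitMuLevel
import Literature.NumberTheory.EllipticCurves.CanonicalPeriodSymbolCongruence
import Literature.NumberTheory.EllipticCurves.CuspFormTwistRatPlusSymbol
import Literature.NumberTheory.GaloisRepresentations.TeichmullerCharacter
import HarnessLib

/-!
# Route `SignedLowerHalves`, crux L `SmallImageLowerHalfBothSigns` (item stmt-BirchSwinnertonDyer-23599), line `rtt_w3` v7 —
# the VALVE KERNEL for the floor stub `stub_muOneSign_ns_ge5` (crux idea `valve`, `Cruxes/SmallImageLowerHalfBothSigns/Ideas/valve.md`):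
# one-sign analytic `μ = 0` for `W` from (B1) an orbit-unit certificate on the CM partner in ANY integral normalisation ∧
# (B2) depleted primitivity of `W`'s symbol ∧ the OUTPUT of Vatsal's congruence ∧ a depletion datum — and the base case of B2

Width seat `bsd-line-slh-p3-w3` g15 under LEAD `cruxlead-stmt-BirchSwinnertonDyer-23599` (cell `bsd-ssimc`); ROUTE-INDEPENDENT helper
(`--supports stmt-BirchSwinnertonDyer-23599`), landing the kernel PROVED in the card's Sketch (cruxidea-23599-1 g8, `Sketch-valve.lean`
46805fb12eabeb95) per the LEAD's g4 ruling (HELPER-TABLE g4 addendum, row 2). THEOREMS ONLY — the card's two bricks B1 (`OrbitUnitCert`)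
and B2 (`DepletedPrimitive`) are NOT declared here: they appear UNFOLDED, as hypotheses (`hB1`, `hB2`) of the kernel. No definition, no
named fact, no `sorry`; closes nothing; BSD / crux L / crux M are proved for NO curve by any of this.

THE VALVE. Among the `p`-integral normalisations `Ω′` of a plus symbol the cohomological (Vatsal canonical) one `Ω^can` is `μ`-MINIMAL
(`φ/Ω^can` integral and a unit somewhere, `φ/Ω′` integral ⟹ `Ω^can/Ω′` integral: `norm_rescale_le_one`), so a UNIT Teichmüller-orbit sum
seen in ANY integral normalisation is one in the canonical normalisation (`norm_rescale_eq_one`): the canonical-period wall (memo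
`Lines/rtt_w3-MEMO-w3-g13.md`) is ONE-WAY — it blocks transporting `μ > 0`, not a `μ = 0` certificate partner → `W`.
§1 ultrametric lemmas (`unit_sum_transfer` = CM half, `norm_eq_one_of_unit_somewhere` = W half, pigeonhole); §2 dilation
`Σ_η [m·(ηb)/pⁿ]⁺_f = S_f(p,n,m·b)`; §3 ★ `exists_norm_teichOrbitSum_eq_one_of_valve` (B1 ∧ B2 ∧ Vatsal-output ∧ depletion datum
⟹ ONE unit orbit sum `‖S_f(p,n,b)‖_p = 1`) and ★ `muOneSign_body_of_valve` (⟹ `∃ ε L, IsSignedPAdicLFunction f p ε L ∧ HasUnitContent L`,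
VERBATIM the body of `stub_muOneSign_ns_ge5` for the newform `f`; tail `teichOrbitSum_eq_coeff_comp_mazurTateElement` +
`exists_sign_hasUnitContent_of_norm_coeff_eq_one`); §4 ★ `exists_norm_ratPlusSymbol_div_pow_eq_one` — BASE CASE of B2: at every odd
supersingular good prime some `[a/pⁿ]⁺_f` is a `p`-adic unit (THEOREM B `EvenBranch.cycWindingNonConstantAt_of_odd`, input-free).
OPEN (the card's pricing, untouched): B1 class-wide = one-sign cyclotomic analytic `μ = 0` for the partner CM newform at the INERT prime (wall W2);
B2's depletion step; the K-chain instance of Vatsal's Conditions 1–2 (the LEAD's cite stub). References: [Vatsal1999] Thm. (1.13), Rem. (1.12);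
[GreenbergVatsal2000] §3 Rem. (3.4); [MazurTateTeitelbaum1986Invent] §I.4 (4.2), §I.10 (10.1); [PollackWeston2011MT] Thm. 4.1 (1); [Pollack2003] Conj. 6.3.
-/

set_option autoImplicit false
-- D-0017: single-problem summit, the namespace repeats the problem name by design.
set_option linter.dupNamespace false
noncomputable section

open Summit.BirchSwinnertonDyer.BirchSwinnertonDyer.Theorems.SmallImageHeckePrimeMu
open scoped Classical MatrixGroups ModularForm

open Polynomial CongruenceSubgroup Literature.NumberTheory.EllipticCurves Literature.NumberTheory.EllipticCurves.ModularForms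
  Literature.NumberTheory.EllipticCurves.Kobayashi2003 Literature.NumberTheory.EllipticCurves.GreenbergVatsal2000
  Literature.NumberTheory.EllipticCurves.Rank1Residual Literature.NumberTheory.GaloisRepresentations

namespace Summit.BirchSwinnertonDyer.BirchSwinnertonDyer.Theorems.SmallImageValve

open Summit.BirchSwinnertonDyer.BirchSwinnertonDyer.Theorems.SmallImageOrbitSumMu (exists_sign_hasUnitContent_of_norm_coeff_eq_one)
open Summit.BirchSwinnertonDyer.BirchSwinnertonDyer.Theorems.SmallImageTeichOrbitMu (teichOrbitSum_eq_coeff_comp_mazurTateElement norm_teichOrbitSum_le_one)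

/-! ## §1 The valve: four ultrametric lemmas (any ultrametric normed field) -/

section Valve

variable {K : Type*} [NormedField K] [IsUltrametricDist K]

omit [IsUltrametricDist K] in
/-- ONE-WAY lemma, integral half: a rescaling `c·v` of a family `v` that is a unit somewhere stays integral only if
`‖c‖ ≤ 1` (`c = Ω^can/Ω′`). [folklore] -/
theorem norm_rescale_le_one {ι : Type*} {v : ι → K} {c : K} {x₀ : ι} (hx₀ : ‖v x₀‖ = 1)
    (hc : ∀ x, ‖c * v x‖ ≤ 1) : ‖c‖ ≤ 1 := by
  simpa [norm_mul, hx₀] using hc x₀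

/-- **The valve.** If `‖c‖ ≤ 1` (the ONE-WAY lemma: `c = Ω^can/Ω′` for another integral normalisation `Ω′`) and
some finite sum `Σ c·w_t` of integral terms `w_t` (values of the canonical family) is a unit, then `c` is a unit and
`Σ w_t` is a unit: `μ = 0` witnessed in ANY integral normalisation is `μ = 0` in the canonical one. [folklore] -/
theorem norm_rescale_eq_one {ι : Type*} {c : K} (hc1 : ‖c‖ ≤ 1) {s : Finset ι} (w : ι → K)
    (hw : ∀ t ∈ s, ‖w t‖ ≤ 1) (hunit : ‖∑ t ∈ s, c * w t‖ = 1) :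
    ‖c‖ = 1 ∧ ‖∑ t ∈ s, w t‖ = 1 := by
  have hS : ‖∑ t ∈ s, w t‖ ≤ 1 :=
    IsUltrametricDist.norm_sum_le_of_forall_le_of_nonneg zero_le_one hw
  rw [← Finset.mul_sum, norm_mul] at hunit
  constructor <;> nlinarith [norm_nonneg c, norm_nonneg (∑ t ∈ s, w t)]

/-- A unit plus something in the maximal ideal is a unit. [folklore] -/
theorem norm_eq_one_of_norm_sub_lt_one {a b : K} (ha : ‖a‖ = 1) (hab : ‖a - b‖ < 1) (hb : ‖b‖ ≤ 1) :
    ‖b‖ = 1 := by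
  refine le_antisymm hb (not_lt.mp fun hlt ↦ ?_)
  have h := IsUltrametricDist.norm_add_le_max (a - b) b
  rw [sub_add_cancel, ha] at h
  exact absurd h (not_le.mpr (max_lt hab hlt))

/-- Termwise congruent finite sums are congruent. [folklore] -/
theorem norm_sum_sub_sum_lt_one {ι : Type*} (s : Finset ι) (a b : ι → K) (h : ∀ i ∈ s, ‖a i - b i‖ < 1) :
    ‖∑ i ∈ s, a i - ∑ i ∈ s, b i‖ < 1 := by
  rw [← Finset.sum_sub_distrib]
  rcases s.eq_empty_or_nonempty with rfl | hs
  · simp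
  · obtain ⟨i, hi, hle⟩ := IsUltrametricDist.exists_norm_finsetSum_le_of_nonempty hs (fun i ↦ a i - b i)
    exact lt_of_le_of_lt hle (h i hi)

/-- Ultrametric pigeonhole: a unit `p`-integral combination of integral terms has a unit term. [folklore] -/
theorem exists_norm_eq_one_of_norm_sum_mul_eq_one {ι : Type*} {s : Finset ι} {c S : ι → K}
    (hc : ∀ i ∈ s, ‖c i‖ ≤ 1) (hS : ∀ i ∈ s, ‖S i‖ ≤ 1) (h : ‖∑ i ∈ s, c i * S i‖ = 1) :
    ∃ i ∈ s, ‖S i‖ = 1 := by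
  rcases s.eq_empty_or_nonempty with rfl | hs
  · simp at h
  obtain ⟨i, hi, hle⟩ := IsUltrametricDist.exists_norm_finsetSum_le_of_nonempty hs (fun i ↦ c i * S i)
  refine ⟨i, hi, le_antisymm (hS i hi) ?_⟩
  rw [h, norm_mul] at hle
  nlinarith [hc i hi, hS i hi, norm_nonneg (c i), norm_nonneg (S i)]

/-- **Unit-sum transfer** (the CM half of the kernel, abstract): `vf, vg` integral and termwise congruent, `vf` a unit
somewhere, `c·vg` integral with a unit finite sum ⟹ the same sum of `vf` is a unit. [folklore] -/
theorem unit_sum_transfer {X T : Type*} {vf vg : X → K} (hvf : ∀ x, ‖vf x‖ ≤ 1) (hvg : ∀ x, ‖vg x‖ ≤ 1)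
    (hvc : ∀ x, ‖vf x - vg x‖ < 1) {x₀ : X} (hx₀ : ‖vf x₀‖ = 1) {c : K} (hc : ∀ x, ‖c * vg x‖ ≤ 1)
    (s : Finset T) (xs : T → X) (hunit : ‖∑ t ∈ s, c * vg (xs t)‖ = 1) :
    ‖∑ t ∈ s, vf (xs t)‖ = 1 := by
  have hx₀g : ‖vg x₀‖ = 1 := norm_eq_one_of_norm_sub_lt_one hx₀ (hvc x₀) (hvg x₀)
  have hc1 : ‖c‖ ≤ 1 := norm_rescale_le_one hx₀g hc
  obtain ⟨-, hSg⟩ := norm_rescale_eq_one hc1 (fun t ↦ vg (xs t)) (fun t _ ↦ hvg _) hunit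
  refine norm_eq_one_of_norm_sub_lt_one hSg ?_
    (IsUltrametricDist.norm_sum_le_of_forall_le_of_nonneg zero_le_one fun t _ ↦ hvf _)
  have h := norm_sum_sub_sum_lt_one s (fun t ↦ vf (xs t)) (fun t ↦ vg (xs t)) fun t _ ↦ hvc _
  rwa [← norm_neg, neg_sub] at h

omit [IsUltrametricDist K] in
/-- **Two-sided valve** (the `W` half, abstract): if `S` is a unit, `cf·S` is integral, and `cf·v₁` is a unit for
some integral `v₁`, then `cf` is a unit (`cf = Ωf/Ω⁺_f`: the canonical and the lattice normalisation agree up to a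
unit as soon as the lattice-normalised depleted symbol is a unit SOMEWHERE). [folklore] -/
theorem norm_eq_one_of_unit_somewhere {S v₁ cf : K} (hS : ‖S‖ = 1) (hle : ‖cf * S‖ ≤ 1) (hv₁ : ‖v₁‖ ≤ 1)
    (hx₁ : ‖cf * v₁‖ = 1) : ‖cf‖ = 1 := by
  rw [norm_mul] at hle hx₁
  refine le_antisymm ?_ ?_ <;> nlinarith [norm_nonneg cf, norm_nonneg v₁]

end Valve

variable {p : ℕ} [Fact p.Prime]

/-! ## §2 The dilation identity (the two bricks B1/B2 of the card are NOT declared here — they enter the kernel UNFOLDED: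
B2 «depleted primitivity» `∃ x : ℚ, ‖Σ_{(c,m)∈J} c·[m x]⁺_f‖_p = 1`; B1 «orbit-unit certificate» `∃ c, (∀ x, ‖c·ι⁻¹(φ_{g₁}(x)/Ωg)‖ ≤ 1) ∧
∃ n ≥ 1, ∃ b ∈ (ℤ/pⁿ)ˣ, ‖Σ_{η^{p−1}=1} c·ι⁻¹(φ_{g₁}(ηb/pⁿ)/Ωg)‖ = 1`) -/

section Dilation

variable {N : ℕ} {f : CuspForm (Gamma0 N) 2}

/-- **Dilation identity.** Multiplying the orbit parameter by a prime-to-`p` integer `m` dilates the cusps inside the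
rational plus symbol: `Σ_η [m·(ηb)/pⁿ]⁺ = S_f(p, n, m·b)` (`[r + k]⁺ = [r]⁺`, `ratPlusSymbol_add_intCast_holds`).
[cite: MazurTateTeitelbaum1986Invent, §I.4 (4.2) and §I.10 (10.1)] -/
theorem sum_ratPlusSymbol_mul_eq_teichOrbitSum [NeZero N] {n : ℕ} (m : ℕ) (b : ZMod (p ^ n)) :
    ∑ t ∈ (Finset.univ : Finset (ZMod (p ^ n))).filter (fun t => t ^ (p - 1) = 1),
        ratPlusSymbol f ((m : ℚ) * ((((t * b).val : ℕ) : ℚ) / (p : ℚ) ^ n))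
      = teichOrbitSum f p n ((m : ZMod (p ^ n)) * b) := by
  have hp : p.Prime := Fact.out
  rw [teichOrbitSum_def]
  refine Finset.sum_congr rfl fun t _ ↦ ?_
  have hcomm : t * ((m : ZMod (p ^ n)) * b) = (m : ZMod (p ^ n)) * (t * b) := by ring
  rw [hcomm]
  set z : ZMod (p ^ n) := t * b with hz
  have hval : (((m : ZMod (p ^ n)) * z).val : ℕ) = (m * z.val) % p ^ n := by
    rw [ZMod.val_mul, ZMod.val_natCast, Nat.mul_mod, Nat.mod_mod, ← Nat.mul_mod]
  have hq : ((p : ℚ) ^ n) ≠ 0 := pow_ne_zero _ (by exact_mod_cast hp.ne_zero)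
  have hdm : (((p : ℚ) ^ n * ((m * z.val / p ^ n : ℕ) : ℚ) + ((m * z.val % p ^ n : ℕ) : ℚ))) =
      (m : ℚ) * (z.val : ℚ) := by
    have h := Nat.div_add_mod (m * z.val) (p ^ n)
    exact_mod_cast h
  have key : (m : ℚ) * ((((z.val : ℕ)) : ℚ) / (p : ℚ) ^ n) =
      ((((m : ZMod (p ^ n)) * z).val : ℕ) : ℚ) / (p : ℚ) ^ n + ((m * z.val / p ^ n : ℕ) : ℚ) := by
    rw [hval]
    field_simp
    linarith [hdm]
  rw [key, ← Int.cast_natCast (R := ℚ) (m * z.val / p ^ n), ratPlusSymbol_add_intCast_holds]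

end Dilation

/-! ## §3 The kernel: B1 ∧ B2 ∧ Vatsal-output ∧ depletion datum ⟹ one unit orbit sum of `f` ⟹ the floor stub body -/

section Kernel

variable {N M : ℕ} [NeZero N] [NeZero M]

omit [NeZero M] in
/-- **Kernel, orbit-sum form.** At an odd prime `p ∤ N` with `a_p(f) = 0` (integrality of orbit sums), for the newform
`f` of `W`, an eigenform pair `(f₁, g₁)` of common level with the OUTPUT of `vatsal1999_plusSymbol_congruence`
(canonical periods `Ωf, Ωg`: integral, congruent, `f₁`-side unit somewhere), a depletion datum `J` expressing `φ_{f₁}`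
through `φ_f`, brick B2 for `(f, J)` and brick B1 for `(g₁, Ωg)`: SOME Teichmüller-orbit sum of `f` itself at a level
`pⁿ`, `n ≥ 1`, is a `p`-adic unit. Proof = §1: unit point transfers `f₁ → g₁` (congruence); the valve makes the B1
rescaling a unit and the canonical `g₁`-orbit sum a unit; congruence moves it to `f₁`; on the `W` side `c_f = ι⁻¹(Ωf/Ω⁺_f)`
has `‖c_f‖ ≤ 1` (integrality of `[a/pⁿ]⁺_f`, tree) and `‖c_f‖ ≥ 1` (B2: a unit value of the `Ω⁺_f`-normalised depleted
symbol), so the `Ω⁺_f`-normalised depleted orbit sum is a unit; dilation + pigeonhole un-deplete it.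
[cite: Vatsal1999, Thm. (1.13) and Remark (1.12)] [cite: MazurTateTeitelbaum1986Invent, §I.10 (10.1)] -/
theorem exists_norm_teichOrbitSum_eq_one_of_valve {W : WeierstrassCurve ℚ} [W.IsElliptic]
    {f : CuspForm (Gamma0 N) 2} (hp2 : p ≠ 2) (hf : IsNewformOf W f) (hpN : ¬ p ∣ N)
    (hap : cuspCoeff f p = ((0 : ℤ) : ℂ))
    (ι : PadicAlgCl p ≃+* ℂ) (f₁ g₁ : CuspForm (Gamma0 M) 2) {Ωf Ωg : ℂ} (hΩf : Ωf ≠ 0)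
    (hVf : ∀ x : ℚ, Valued.v (ι.symm (plusSymbol f₁ x / Ωf)) ≤ 1)
    (hVg : ∀ x : ℚ, Valued.v (ι.symm (plusSymbol g₁ x / Ωg)) ≤ 1)
    (hVc : ∀ x : ℚ, Valued.v (ι.symm (plusSymbol f₁ x / Ωf - plusSymbol g₁ x / Ωg)) < 1)
    (hVu : ∃ x : ℚ, Valued.v (ι.symm (plusSymbol f₁ x / Ωf)) = 1)
    (J : Finset (ℚ × ℕ)) (hJ : ∀ jm ∈ J, ‖((jm.1 : ℚ) : ℚ_[p])‖ ≤ 1 ∧ ¬ p ∣ jm.2)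
    (hdep : ∀ x : ℚ, plusSymbol f₁ x = ∑ jm ∈ J, ((jm.1 : ℚ) : ℂ) * plusSymbol f ((jm.2 : ℚ) * x))
    (hB2 : ∃ x : ℚ, ‖((∑ jm ∈ J, jm.1 * ratPlusSymbol f ((jm.2 : ℚ) * x) : ℚ) : ℚ_[p])‖ = 1)
    (hB1 : ∃ c : PadicAlgCl p, (∀ x : ℚ, ‖c * ι.symm (plusSymbol g₁ x / Ωg)‖ ≤ 1) ∧
      ∃ n : ℕ, 1 ≤ n ∧ ∃ b : (ZMod (p ^ n))ˣ,
        ‖∑ t ∈ (Finset.univ : Finset (ZMod (p ^ n))).filter (fun t => t ^ (p - 1) = 1),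
            c * ι.symm (plusSymbol g₁ ((((t * (b : ZMod (p ^ n))).val : ℕ) : ℚ) / (p : ℚ) ^ n) / Ωg)‖ = 1) :
    ∃ n : ℕ, 1 ≤ n ∧ ∃ b : (ZMod (p ^ n))ˣ, ‖((teichOrbitSum f p n (b : ZMod (p ^ n)) : ℚ) : ℚ_[p])‖ = 1 := by
  have hp : p.Prime := Fact.out
  have hf0 : IsNewform0 f := hf.1
  have hQ : coeffField f = ⊥ := hf.coeffField_eq_bot
  have hΩpos : 0 < plusPeriod f := IsNewform0.plusPeriod_pos_holds hf0 hQ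
  have hΩ : (plusPeriod f : ℂ) ≠ 0 := by exact_mod_cast hΩpos.ne'
  -- Vatsal's output in norm currency (`Valued.v z = ‖z‖₊` on `ℚ̄_p`); `‖q‖` of a rational read in `ℚ̄_p` is `‖q‖` in `ℚ_p`
  have hvf_le : ∀ x : ℚ, ‖ι.symm (plusSymbol f₁ x / Ωf)‖ ≤ 1 := fun x ↦ (PadicAlgCl.valuation_le_one_iff _).mp (hVf x)
  have hvg_le : ∀ x : ℚ, ‖ι.symm (plusSymbol g₁ x / Ωg)‖ ≤ 1 := fun x ↦ (PadicAlgCl.valuation_le_one_iff _).mp (hVg x)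
  have hvc : ∀ x : ℚ, ‖ι.symm (plusSymbol f₁ x / Ωf) - ι.symm (plusSymbol g₁ x / Ωg)‖ < 1 := fun x ↦ by
    rw [← map_sub, ← coe_nnnorm, ← NNReal.coe_one, NNReal.coe_lt_coe, ← PadicAlgCl.valuation_def]; exact hVc x
  obtain ⟨x₀, hx₀v⟩ := hVu
  have hx₀ : ‖ι.symm (plusSymbol f₁ x₀ / Ωf)‖ = 1 := (PadicAlgCl.valuation_eq_one_iff _).mp hx₀v
  have nrc : ∀ q : ℚ, ‖(q : PadicAlgCl p)‖ = ‖(q : ℚ_[p])‖ := fun q ↦ by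
    rw [← map_ratCast (algebraMap ℚ_[p] (PadicAlgCl p)) q]; exact PadicAlgCl.norm_extends p _
  -- B1 + the valve on the CM side + congruence: the canonical `f₁`-orbit sum is a unit
  obtain ⟨c, hcint, n, hn, b, hunit⟩ := hB1
  have hSf : ‖∑ t ∈ (Finset.univ : Finset (ZMod (p ^ n))).filter (fun t => t ^ (p - 1) = 1),
      ι.symm (plusSymbol f₁ ((((t * (b : ZMod (p ^ n))).val : ℕ) : ℚ) / (p : ℚ) ^ n) / Ωf)‖ = 1 :=
    unit_sum_transfer (vf := fun x ↦ ι.symm (plusSymbol f₁ x / Ωf)) (vg := fun x ↦ ι.symm (plusSymbol g₁ x / Ωg))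
      hvf_le hvg_le hvc hx₀ hcint _ (fun t ↦ (((t * (b : ZMod (p ^ n))).val : ℕ) : ℚ) / (p : ℚ) ^ n) hunit
  -- the W side: `c_f · (φ_{f₁}/Ωf) = dep` with `c_f = ι⁻¹(Ωf/Ω⁺_f)`, `dep x = Σ_j c_j [m_j x]⁺_f` the depleted symbol
  have hdepΩ : ∀ x : ℚ, plusSymbol f₁ x =
      ((∑ jm ∈ J, jm.1 * ratPlusSymbol f ((jm.2 : ℚ) * x) : ℚ) : ℂ) * (plusPeriod f : ℂ) := by
    intro x
    rw [hdep x]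
    push_cast
    rw [Finset.sum_mul]
    refine Finset.sum_congr rfl fun jm _ ↦ ?_
    rw [← ratCast_ratPlusSymbol_mul_plusPeriod f hf0 hQ ((jm.2 : ℚ) * x)]
    ring
  have hcf_ne : ι.symm (Ωf / (plusPeriod f : ℂ)) ≠ 0 :=
    (map_ne_zero ι.symm).mpr (div_ne_zero hΩf hΩ)
  have hcfv : ∀ x : ℚ, ι.symm (Ωf / (plusPeriod f : ℂ)) * ι.symm (plusSymbol f₁ x / Ωf) =
      ((∑ jm ∈ J, jm.1 * ratPlusSymbol f ((jm.2 : ℚ) * x) : ℚ) : PadicAlgCl p) := by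
    intro x
    rw [← map_mul, ← map_ratCast ι.symm (∑ jm ∈ J, jm.1 * ratPlusSymbol f ((jm.2 : ℚ) * x))]
    congr 1
    rw [hdepΩ x]
    set d : ℚ := ∑ jm ∈ J, jm.1 * ratPlusSymbol f ((jm.2 : ℚ) * x)
    field_simp
  -- integrality of the depleted symbol at the orbit's cusps (tree: `‖[a/pⁿ]⁺_f‖ ≤ 1` when `a_p = 0`)
  have hdep_le : ∀ t : ZMod (p ^ n),
      ‖((∑ jm ∈ J, jm.1 * ratPlusSymbol f ((jm.2 : ℚ) * ((((t * (b : ZMod (p ^ n))).val : ℕ) : ℚ) / (p : ℚ) ^ n)) : ℚ) : ℚ_[p])‖ ≤ 1 := by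
    intro t
    push_cast
    refine IsUltrametricDist.norm_sum_le_of_forall_le_of_nonneg zero_le_one fun jm hjm ↦ ?_
    rw [norm_mul]
    refine mul_le_one₀ (hJ jm hjm).1 (norm_nonneg _) ?_
    have h := norm_ratPlusSymbol_intCast_div_pow_le_one f hp2 hf0 hpN hap
      (((jm.2 * (t * (b : ZMod (p ^ n))).val : ℕ) : ℤ)) n
    have harg : (jm.2 : ℚ) * ((((t * (b : ZMod (p ^ n))).val : ℕ) : ℚ) / (p : ℚ) ^ n) =
        ((((jm.2 * (t * (b : ZMod (p ^ n))).val : ℕ) : ℤ) : ℚ)) / (p : ℚ) ^ n := by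
      push_cast; ring
    rwa [harg]
  obtain ⟨x₁, hx₁⟩ := hB2
  have hx₁' : ‖ι.symm (Ωf / (plusPeriod f : ℂ)) * ι.symm (plusSymbol f₁ x₁ / Ωf)‖ = 1 := by
    rw [hcfv, nrc]; exact hx₁
  have hsum_eq : (∑ t ∈ (Finset.univ : Finset (ZMod (p ^ n))).filter (fun t => t ^ (p - 1) = 1),
      ((∑ jm ∈ J, jm.1 * ratPlusSymbol f ((jm.2 : ℚ) * ((((t * (b : ZMod (p ^ n))).val : ℕ) : ℚ) / (p : ℚ) ^ n)) : ℚ) : PadicAlgCl p)) =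
      ι.symm (Ωf / (plusPeriod f : ℂ)) * ∑ t ∈ (Finset.univ : Finset (ZMod (p ^ n))).filter (fun t => t ^ (p - 1) = 1),
        ι.symm (plusSymbol f₁ ((((t * (b : ZMod (p ^ n))).val : ℕ) : ℚ) / (p : ℚ) ^ n) / Ωf) := by
    rw [Finset.mul_sum]
    exact Finset.sum_congr rfl fun t _ ↦ (hcfv _).symm
  have hle : ‖ι.symm (Ωf / (plusPeriod f : ℂ)) * ∑ t ∈ (Finset.univ : Finset (ZMod (p ^ n))).filter (fun t => t ^ (p - 1) = 1),
        ι.symm (plusSymbol f₁ ((((t * (b : ZMod (p ^ n))).val : ℕ) : ℚ) / (p : ℚ) ^ n) / Ωf)‖ ≤ 1 := by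
    rw [← hsum_eq]
    refine IsUltrametricDist.norm_sum_le_of_forall_le_of_nonneg zero_le_one fun t _ ↦ ?_
    rw [nrc]; exact hdep_le t
  have hcf1 : ‖ι.symm (Ωf / (plusPeriod f : ℂ))‖ = 1 :=
    norm_eq_one_of_unit_somewhere hSf hle (hvf_le x₁) hx₁'
  -- the `Ω⁺_f`-normalised depleted orbit sum is a unit
  have hSdep : ‖((∑ t ∈ (Finset.univ : Finset (ZMod (p ^ n))).filter (fun t => t ^ (p - 1) = 1),
      ∑ jm ∈ J, jm.1 * ratPlusSymbol f ((jm.2 : ℚ) * ((((t * (b : ZMod (p ^ n))).val : ℕ) : ℚ) / (p : ℚ) ^ n)) : ℚ) : ℚ_[p])‖ = 1 := by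
    rw [← nrc, Rat.cast_sum, hsum_eq, norm_mul, hcf1, hSf, one_mul]
  -- un-deplete: swap the sums, dilate, pigeonhole
  have hswap : (∑ t ∈ (Finset.univ : Finset (ZMod (p ^ n))).filter (fun t => t ^ (p - 1) = 1),
      ∑ jm ∈ J, jm.1 * ratPlusSymbol f ((jm.2 : ℚ) * ((((t * (b : ZMod (p ^ n))).val : ℕ) : ℚ) / (p : ℚ) ^ n)) : ℚ) =
      ∑ jm ∈ J, jm.1 * teichOrbitSum f p n ((jm.2 : ZMod (p ^ n)) * (b : ZMod (p ^ n))) := by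
    rw [Finset.sum_comm]
    refine Finset.sum_congr rfl fun jm _ ↦ ?_
    rw [← Finset.mul_sum, sum_ratPlusSymbol_mul_eq_teichOrbitSum]
  rw [hswap] at hSdep
  push_cast at hSdep
  obtain ⟨jm, hjm, hone⟩ := exists_norm_eq_one_of_norm_sum_mul_eq_one
    (c := fun jm : ℚ × ℕ ↦ ((jm.1 : ℚ) : ℚ_[p]))
    (S := fun jm : ℚ × ℕ ↦ ((teichOrbitSum f p n ((jm.2 : ZMod (p ^ n)) * (b : ZMod (p ^ n))) : ℚ) : ℚ_[p]))
    (fun jm hjm ↦ (hJ jm hjm).1) (fun jm _ ↦ norm_teichOrbitSum_le_one f hp2 hf0 hpN hap n _) hSdep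
  -- the dilated parameter is again a unit mod `pⁿ`
  have hcop : Nat.Coprime jm.2 (p ^ n) :=
    Nat.Coprime.pow_right n ((Nat.Prime.coprime_iff_not_dvd hp).mpr (hJ jm hjm).2).symm
  exact ⟨n, hn, ZMod.unitOfCoprime jm.2 hcop * b, by rw [Units.val_mul, ZMod.coe_unitOfCoprime]; exact hone⟩

omit [NeZero M] in
/-- **Kernel, stub form: the one-sign analytic `μ = 0` floor at `(W, p, f)`** — VERBATIM the conclusion of LEAD stub
`stub_muOneSign_ns_ge5` (`Lines/rtt_w3.lean` v6) for the newform `f` — from B1 ∧ B2 ∧ Vatsal-output ∧ depletion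
datum, at any odd good prime with `a_p = 0` (no `p ≥ 5`, no image hypothesis needed by the kernel; they are where B1's
partner comes from). Tail = the tree's `teichOrbitSum = coeff θ_{n−1}` and `exists_sign_hasUnitContent_of_norm_coeff_eq_one`.
[cite: MazurTateTeitelbaum1986Invent, §I.10 (10.1)] [cite: PollackWeston2011, Thm. 4.1 (1)] [cite: Vatsal1999, Thm. (1.13)] -/
theorem muOneSign_body_of_valve {W : WeierstrassCurve ℚ} [W.IsElliptic] [W.IsGloballyMinimal]
    {f : CuspForm (Gamma0 N) 2} (hp2 : p ≠ 2) (hf : IsNewformOf W f) (hgood : W.HasGoodReductionAtPrime p)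
    (hap : W.frobeniusTrace p = 0)
    (ι : PadicAlgCl p ≃+* ℂ) (f₁ g₁ : CuspForm (Gamma0 M) 2) {Ωf Ωg : ℂ} (hΩf : Ωf ≠ 0)
    (hVf : ∀ x : ℚ, Valued.v (ι.symm (plusSymbol f₁ x / Ωf)) ≤ 1)
    (hVg : ∀ x : ℚ, Valued.v (ι.symm (plusSymbol g₁ x / Ωg)) ≤ 1)
    (hVc : ∀ x : ℚ, Valued.v (ι.symm (plusSymbol f₁ x / Ωf - plusSymbol g₁ x / Ωg)) < 1)
    (hVu : ∃ x : ℚ, Valued.v (ι.symm (plusSymbol f₁ x / Ωf)) = 1)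
    (J : Finset (ℚ × ℕ)) (hJ : ∀ jm ∈ J, ‖((jm.1 : ℚ) : ℚ_[p])‖ ≤ 1 ∧ ¬ p ∣ jm.2)
    (hdep : ∀ x : ℚ, plusSymbol f₁ x = ∑ jm ∈ J, ((jm.1 : ℚ) : ℂ) * plusSymbol f ((jm.2 : ℚ) * x))
    (hB2 : ∃ x : ℚ, ‖((∑ jm ∈ J, jm.1 * ratPlusSymbol f ((jm.2 : ℚ) * x) : ℚ) : ℚ_[p])‖ = 1)
    (hB1 : ∃ c : PadicAlgCl p, (∀ x : ℚ, ‖c * ι.symm (plusSymbol g₁ x / Ωg)‖ ≤ 1) ∧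
      ∃ n : ℕ, 1 ≤ n ∧ ∃ b : (ZMod (p ^ n))ˣ,
        ‖∑ t ∈ (Finset.univ : Finset (ZMod (p ^ n))).filter (fun t => t ^ (p - 1) = 1),
            c * ι.symm (plusSymbol g₁ ((((t * (b : ZMod (p ^ n))).val : ℕ) : ℚ) / (p : ℚ) ^ n) / Ωg)‖ = 1) :
    ∃ (ε : ℤˣ) (L : IwasawaAlgebra p), IsSignedPAdicLFunction f p ε L ∧ HasUnitContent L := by
  have hp : p.Prime := Fact.out
  have hpN : ¬ p ∣ N := not_dvd_level_of_isNewformOf hf hgood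
  have hap' : cuspCoeff f p = ((0 : ℤ) : ℂ) := by
    rw [cuspCoeff_eq_frobeniusTrace_of_isNewformOf_holds hf hgood, hap]
  obtain ⟨m, hm, b, hb1⟩ :=
    exists_norm_teichOrbitSum_eq_one_of_valve hp2 hf hpN hap' ι f₁ g₁ hΩf hVf hVg hVc hVu J hJ hdep hB2 hB1
  obtain ⟨n, rfl⟩ : ∃ n, m = n + 1 := ⟨m - 1, by omega⟩
  obtain ⟨ξ₀, s, hb⟩ := exists_coe_eq_toZModPow_mul_pow hp2 n b
  have hs : s.val < p ^ n := by
    haveI : NeZero (p ^ n) := ⟨pow_ne_zero _ hp.ne_zero⟩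
    exact ZMod.val_lt s
  rw [teichOrbitSum_eq_coeff_comp_mazurTateElement f hp2 n ξ₀ hs (b : ZMod (p ^ (n + 1))) hb] at hb1
  exact exists_sign_hasUnitContent_of_norm_coeff_eq_one hp2 hf hgood hap hb1

end Kernel

/-! ## §4 The base case of B2 (no depletion) is THEOREM B -/

section Base

variable {N : ℕ} [NeZero N]

/-- ★ **Base case of B2, sharp form: some `p`-power cusp value `[a/pⁿ]⁺_f` of the newform of `W` is a `p`-adic UNIT**
at every odd supersingular good prime (`a_p(W) = 0`). THEOREM B (`EvenBranch.cycWindingNonConstantAt_of_odd`, input-free;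
`W[p]` is irreducible since `p ∣ a_p = 0`, `hasIrreducibleModPGaloisRep_of_dvd_frobeniusTrace`) gives two `p`-power cusps whose
symbols differ by a `p`-adic unit; both are `p`-integral (`norm_ratPlusSymbol_intCast_div_pow_le_one`, `a_p = 0`), so one of them
is a unit (ultrametric: a difference of two non-units is a non-unit). This is `μ(θ_n(f)) = 0` at ONE layer, branch-free — NOT the
floor (which asks a unit ω⁰-ORBIT SUM). [cite: MazurTateTeitelbaum1986Invent, §I.10 (10.1)] -/
theorem exists_norm_ratPlusSymbol_div_pow_eq_one {W : WeierstrassCurve ℚ} [W.IsElliptic] [W.IsGloballyMinimal]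
    {f : CuspForm (Gamma0 N) 2} (hp2 : p ≠ 2) (hf : IsNewformOf W f) (hgood : W.HasGoodReductionAtPrime p)
    (hap : W.frobeniusTrace p = 0) :
    ∃ (n : ℕ) (a : ℤ), ‖((ratPlusSymbol f ((a : ℚ) / (p : ℚ) ^ n) : ℚ) : ℚ_[p])‖ = 1 := by
  have hpN : ¬ p ∣ N := not_dvd_level_of_isNewformOf hf hgood
  have hap' : cuspCoeff f p = ((0 : ℤ) : ℂ) := by
    rw [cuspCoeff_eq_frobeniusTrace_of_isNewformOf_holds hf hgood, hap]
  have hirr : W.HasIrreducibleModPGaloisRep p :=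
    hasIrreducibleModPGaloisRep_of_dvd_frobeniusTrace W p hp2
      (W.not_dvd_minimalDiscriminantInt_of_hasGoodReductionAtPrime' p hgood) (by rw [hap]; exact dvd_zero _)
  obtain ⟨n, a, a', h1⟩ :=
    Summit.BirchSwinnertonDyer.BirchSwinnertonDyer.Rank1Residual.EvenBranch.cycWindingNonConstantAt_of_odd
      W p hp2 hgood hirr f hf
  have hint : ∀ c : ℤ, ‖((ratPlusSymbol f ((c : ℚ) / (p : ℚ) ^ n) : ℚ) : ℚ_[p])‖ ≤ 1 := fun c ↦
    norm_ratPlusSymbol_intCast_div_pow_le_one f hp2 hf.1 hpN hap' c n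
  -- one of the two values is a unit (ultrametric: a difference of two non-units is a non-unit)
  by_cases ha : ‖((ratPlusSymbol f ((a : ℚ) / (p : ℚ) ^ n) : ℚ) : ℚ_[p])‖ = 1
  · exact ⟨n, a, ha⟩
  · refine ⟨n, a', ?_⟩
    have ha_lt : ‖((ratPlusSymbol f ((a : ℚ) / (p : ℚ) ^ n) : ℚ) : ℚ_[p])‖ < 1 := lt_of_le_of_ne (hint a) ha
    by_contra ha'
    refine absurd h1 (not_le.mpr ?_)
    push_cast
    rw [sub_eq_add_neg]
    exact lt_of_le_of_lt (IsUltrametricDist.norm_add_le_max _ _)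
      (max_lt ha_lt (by rw [norm_neg]; exact lt_of_le_of_ne (hint a') ha'))

/-- **B2 holds for the undepleted symbol** — the base case of the card's brick B2 in the kernel's currency (depletion datum
`J = {(1,1)}`: `Σ_{(c,m)∈J} c·[m x]⁺_f = [x]⁺_f`) at every odd supersingular good prime: some cusp value of the `Ω⁺_f`-normalised
plus symbol is a `p`-adic unit (`exists_norm_ratPlusSymbol_div_pow_eq_one`). [cite: MazurTateTeitelbaum1986Invent, §I.10 (10.1)] -/
theorem depletedPrimitive_base {W : WeierstrassCurve ℚ} [W.IsElliptic] [W.IsGloballyMinimal]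
    {f : CuspForm (Gamma0 N) 2} (hp2 : p ≠ 2) (hf : IsNewformOf W f) (hgood : W.HasGoodReductionAtPrime p)
    (hap : W.frobeniusTrace p = 0) :
    ∃ x : ℚ, ‖((∑ jm ∈ ({((1 : ℚ), 1)} : Finset (ℚ × ℕ)), jm.1 * ratPlusSymbol f ((jm.2 : ℚ) * x) : ℚ) : ℚ_[p])‖ = 1 := by
  obtain ⟨n, a, ha⟩ := exists_norm_ratPlusSymbol_div_pow_eq_one hp2 hf hgood hap
  exact ⟨(a : ℚ) / (p : ℚ) ^ n, by simpa using ha⟩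

end Base

end Summit.BirchSwinnertonDyer.BirchSwinnertonDyer.Theorems.SmallImageValve

end
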